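import Mathlib.Analysis.Complex.LocallyUniformLimit
import Mathlib.Analysis.Complex.TaylorSeries
import Mathlib.Analysis.Complex.CauchyIntegral
import Mathlib.Analysis.Normed.Module.MultipliableUniformlyOn
import Mathlib.Analysis.SpecialFunctions.Log.Summable
import Mathlib.Analysis.SpecialFunctions.Complex.Arg
import Mathlib.Algebra.Polynomial.Lifts
import Mathlib.Data.Set.Card
import Literature.Analysis.TotalPositivity.PolyaFrequencyEntire
import Literature.Analysis.TotalPositivity.MultiplyPositive
import Literature.Analysis.Complex.HadamardGenusZero
import HarnessLib

/-!
# `PF_m` Taylor sequences of real entire functions of genus zero with zeros in a sector — proved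

Trunk T-ANALYSIS (Literature/Analysis/TotalPositivity). Node G1 of the decomposition of
`Literature.NumberTheory.LFunctions.katkova_pf44` (Katkova 2006, Thm. 1: `ξ₁ ∈ PF₄₄`), see
`Literature/NumberTheory/LFunctions/XiMultiplePositivity.lean` and `MultiplyPositive.lean`.

Katkova's proof of Thm. 1 [Katkova2006, arXiv p. 4] is, verbatim, an argument about an arbitrary
real entire function `f` of order `< 1` with `f(0) > 0` whose zeros `z_k` all satisfy
`|π - arg z_k| ≤ π/(m+1)`: "by the Hadamard theorem we have `f(z) = C ∏ (1 - z/z_k)`, `C > 0`,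
`Σ 1/|z_k| < ∞` … Consider the polynomials `P_N(z) = C ∏_{k ≤ N} (1 - z/z_k)`. For every `N` the
polynomial `P_N` has no zeros in the angle `|arg z| < πm/(m+1)`. So by Theorem B we have
`P_N ∈ PF_m`. The function `f` is the uniform limit, on compact subsets of `ℂ`, of polynomials
`P_N`. Hence `f ∈ PF_m`." We prove exactly this statement,
`isMultiplyPositiveSeq_taylor_of_zeros_in_sector`, from the two printed inputs, both taken as
hypotheses (named facts of the tree): Hadamard's factorisation in genus `0`
(`Literature.Analysis.Complex.hadamard_genus_zero`, [Conway 1978, XI.3.4]) and Schoenberg's sector theorem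
(`Literature.Analysis.TotalPositivity.schoenberg_sector_pf`, [Katkova2006, §1 Thm. B] = [Schoenberg 1955]).

One point the printed proof leaves implicit is made explicit here: Theorem B is about REAL
polynomials, and a partial product of an arbitrary enumeration of the zeros is not real. We use
the partial products over the level sets `{k : |z_k| ≤ M}` ("zeros ordered by modulus"), which
are real polynomials because the zeros of a real entire function are symmetric under conjugation
WITH multiplicities. In terms of Hadamard's data (`f(z)/f(0) = ∏ₙ (1 - bₙ z)`, `Σ |bₙ| < ∞`) this
symmetry reads `#{n : bₙ = β} = #{n : bₙ = conj β}` (`ncard_fiber_conj`), which we prove by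
factoring the fibre out of the product (`hasProd_factor_fiber`) and comparing with the conjugate
product via the elementary uniqueness `eq_of_pow_mul_eq_pow_mul` (no analytic-order theory is
needed: two continuous cofactors non-vanishing at `1/β` force equal exponents).

## Main results (all proved; the two named facts enter as hypotheses `hH`, `hB`)

* `hasProd_factor_fiber`, `eq_of_pow_mul_eq_pow_mul`, `ncard_fiber_conj` — multiplicities.
* `symmTrunc hb M` — the symmetric truncation sets (all `n` with `‖bₙ‖ ≥ 1/(M+1)`, padded with the
  first `M` indices carrying `bₙ = 0`): `mem_symmTrunc`, `monotone_symmTrunc`, `tendsto_symmTrunc`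
  (they exhaust `ℕ`), `filter_symmTrunc_eq`, and `prod_symmTrunc_conj` — the partial products
  `∏_{n ∈ symmTrunc hb M} (1 - bₙ z)` commute with conjugation when `g = ∏ (1 - bₙ z)` does.
* `truncPoly c b s = C c · ∏_{n ∈ s} (1 - C bₙ · X) ∈ ℂ[X]`: `eval_truncPoly`, `map_conj_truncPoly`
  (fixed by conjugation when `c` is real and the product is conjugation-symmetric),
  `exists_map_ofReal_eq` (a conjugation-fixed polynomial comes from `ℝ[X]`).
* `tendstoLocallyUniformlyOn_finsetProd_one_add` — `∏_{n ∈ u N} (1 + cₙ z) → ∏ (1 + cₙ z)` locally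
  uniformly along any `u → atTop`; the zeros of the partial products are zeros of `f` (inline in
  the main proof).
* `isMultiplyPositiveSeq_taylor_of_zeros_in_sector` — the theorem displayed above.

## References

* O. M. Katkova, *Multiple positivity and the Riemann zeta-function*, CMFT 7 (2007) 13–31;
  arXiv:math/0505174, §1, Thm. B and proof of Thm. 1. [Katkova2006]
* I. J. Schoenberg, *A note on multiply positive sequences and the Descartes rule of signs*,
  Rend. Circ. Mat. Palermo (2) 4 (1955) 123–131. [Schoenberg1955]
* J. B. Conway, *Functions of One Complex Variable I*, 2nd ed. 1978, Ch. XI, Thm. 3.4. [Conway1978]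
-/

noncomputable section

open Filter Complex Polynomial Set Metric
open scoped Topology Nat ComplexConjugate

namespace Literature.Analysis.TotalPositivity

/-! ### Fibres of an absolutely summable sequence -/

/-- A non-zero value is taken only finitely often by a sequence with `Σ ‖bₙ‖ < ∞`. [folklore] -/
theorem finite_fiber_of_summable_norm {b : ℕ → ℂ} (hb : Summable fun n => ‖b n‖) {β : ℂ}
    (hβ : β ≠ 0) : Set.Finite {n | b n = β} := by
  have ht : Tendsto (fun n => ‖b n‖) atTop (𝓝 0) := hb.tendsto_atTop_zero
  have hev : ∀ᶠ n in atTop, ‖b n‖ < ‖β‖ := ht.eventually (gt_mem_nhds (norm_pos_iff.2 hβ))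
  obtain ⟨N, hN⟩ := eventually_atTop.1 hev
  refine (Set.finite_lt_nat N).subset fun n hn => ?_
  by_contra hle
  have := hN n (not_lt.1 hle)
  rw [show b n = β from hn] at this
  exact lt_irrefl _ this

/-- More generally, a level set `{n : ε ≤ ‖bₙ‖}`, `ε > 0`, of a sequence with `Σ ‖bₙ‖ < ∞` is
finite. [folklore] -/
theorem finite_levelSet_of_summable_norm {b : ℕ → ℂ} (hb : Summable fun n => ‖b n‖) {ε : ℝ}
    (hε : 0 < ε) : Set.Finite {n | ε ≤ ‖b n‖} := by
  have ht : Tendsto (fun n => ‖b n‖) atTop (𝓝 0) := hb.tendsto_atTop_zero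
  have hev : ∀ᶠ n in atTop, ‖b n‖ < ε := ht.eventually (gt_mem_nhds hε)
  obtain ⟨N, hN⟩ := eventually_atTop.1 hev
  refine (Set.finite_lt_nat N).subset fun n hn => ?_
  by_contra hle
  exact absurd (hN n (not_lt.1 hle)) (not_lt.2 hn)

/-! ### Factoring a fibre out of the Hadamard product -/

/-- **Factoring out one zero.** If `g(z) = ∏ₙ (1 - bₙ z)` (unconditionally, for every `z`) with
`Σ ‖bₙ‖ < ∞` and `β ≠ 0`, then `g(z) = (1 - βz)^k · G(z)` with `k = #{n : bₙ = β}` and `G`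
continuous (indeed entire) with `G(1/β) ≠ 0`. [Conway 1978, Ch. VII §5 (zeros of infinite
products)] [folklore] -/
theorem hasProd_factor_fiber {b : ℕ → ℂ} (hb : Summable fun n => ‖b n‖) {g : ℂ → ℂ}
    (hprod : ∀ z, HasProd (fun n => 1 - b n * z) (g z)) {β : ℂ} (hβ : β ≠ 0) :
    ∃ G : ℂ → ℂ, Continuous G ∧ G β⁻¹ ≠ 0 ∧
      ∀ z, g z = (1 - β * z) ^ ({n | b n = β}.ncard) * G z := by
  classical
  have hfin := finite_fiber_of_summable_norm hb hβ
  set S : Finset ℕ := hfin.toFinset with hS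
  have hmemS : ∀ n, n ∈ S ↔ b n = β := fun n => by simp [hS]
  have hcard : ({n | b n = β} : Set ℕ).ncard = S.card := Set.ncard_eq_toFinset_card _ hfin
  -- the sequence with the fibre removed, written as `1 + c n * z`
  set c : ℕ → ℂ := fun n => if b n = β then 0 else -b n with hc
  have hcs : Summable fun n => ‖c n‖ := by
    refine hb.of_nonneg_of_le (fun n => norm_nonneg _) fun n => ?_
    simp only [hc]
    split_ifs <;> simp
  refine ⟨fun z => ∏' n, (1 + c n * z), (differentiable_tprod_one_add hcs).continuous, ?_, ?_⟩
  · -- non-vanishing at `1/β`: no factor vanishes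
    refine tprod_one_add_ne_zero_of_summable (fun n => ?_)
      (by simpa [norm_mul] using hcs.mul_right ‖β⁻¹‖)
    simp only [hc]
    split_ifs with hn
    · simp
    · intro h0
      apply hn
      have h1 : b n * β⁻¹ = 1 := by linear_combination -h0
      have h2 := (inv_eq_of_mul_eq_one_right h1)  -- (b n)⁻¹ = β⁻¹
      exact inv_injective h2
  · intro z
    -- the finitely supported part
    have h1 : HasProd (fun n => if b n = β then (1 - β * z) else 1) ((1 - β * z) ^ S.card) := by
      have := hasProd_prod_of_ne_finset_one (L := SummationFilter.unconditional ℕ)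
        (f := fun n => if b n = β then (1 - β * z) else 1)
        (s := S) (fun n hn => by rw [if_neg ((hmemS n).not.1 hn)])
      rw [Finset.prod_congr rfl (fun n hn => if_pos ((hmemS n).1 hn)), Finset.prod_const] at this
      exact this
    have h2 : HasProd (fun n => 1 + c n * z) (∏' n, (1 + c n * z)) := hasProd_one_add hcs z
    have h12 := h1.mul h2
    have hpt : (fun n => (if b n = β then (1 - β * z) else 1) * (1 + c n * z)) =
        fun n => 1 - b n * z := by
      funext n
      simp only [hc]
      split_ifs with hn
      · rw [hn]; ring
      · ring
    rw [hpt] at h12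
    rw [hcard]
    exact (hprod z).unique h12

/-- **Uniqueness of the exponent.** If `(1 - βz)^{k₁} G₁(z) = (1 - βz)^{k₂} G₂(z)` for all `z`,
with `G₁, G₂` continuous and non-zero at `1/β`, then `k₁ = k₂` (compare along `z → 1/β`).
[folklore] -/
theorem eq_of_pow_mul_eq_pow_mul {β : ℂ} (hβ : β ≠ 0) {k₁ k₂ : ℕ} {G₁ G₂ : ℂ → ℂ}
    (h₁ : Continuous G₁) (h₂ : Continuous G₂) (hG₁ : G₁ β⁻¹ ≠ 0) (hG₂ : G₂ β⁻¹ ≠ 0)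
    (h : ∀ z, (1 - β * z) ^ k₁ * G₁ z = (1 - β * z) ^ k₂ * G₂ z) : k₁ = k₂ := by
  -- the asymmetric half
  have key : ∀ {k₁ k₂ : ℕ} {G₁ G₂ : ℂ → ℂ}, Continuous G₁ → Continuous G₂ → G₁ β⁻¹ ≠ 0 →
      (∀ z, (1 - β * z) ^ k₁ * G₁ z = (1 - β * z) ^ k₂ * G₂ z) → ¬ k₁ < k₂ := by
    intro k₁ k₂ G₁ G₂ h₁ h₂ hG₁ h hlt
    obtain ⟨d, rfl⟩ := Nat.exists_eq_add_of_lt hlt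
    -- off `1/β` we may cancel `(1 - βz)^{k₁}`
    have heq : EqOn G₁ (fun z => (1 - β * z) ^ (d + 1) * G₂ z) ({β⁻¹}ᶜ : Set ℂ) := by
      intro z hz
      have hz' : 1 - β * z ≠ 0 := by
        intro h0
        apply hz
        have : β * z = 1 := by linear_combination -h0
        exact (inv_eq_of_mul_eq_one_right this).symm ▸ rfl
      have := h z
      rw [show k₁ + d + 1 = k₁ + (d + 1) by ring, pow_add, mul_assoc] at this
      exact mul_left_cancel₀ (pow_ne_zero _ hz') this
    have hall := Continuous.ext_on (dense_compl_singleton _) h₁ (by fun_prop) heq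
    have := congrFun hall β⁻¹
    simp only [mul_inv_cancel₀ hβ, sub_self, ne_eq, Nat.add_eq_zero_iff, one_ne_zero, and_false,
      not_false_eq_true, zero_pow, zero_mul] at this
    exact hG₁ this
  rcases lt_trichotomy k₁ k₂ with hlt | heq | hgt
  · exact absurd hlt (key h₁ h₂ hG₁ h)
  · exact heq
  · exact absurd hgt (key h₂ h₁ hG₂ fun z => (h z).symm)

/-- **Conjugation symmetry of multiplicities.** If `g(z) = ∏ₙ (1 - bₙ z)` for all `z` with
`Σ ‖bₙ‖ < ∞` and `g` is real (`g(conj z) = conj g(z)`), then for `β ≠ 0` the value `β` and its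
conjugate are taken by `(bₙ)` the same (finite) number of times — the zeros `1/bₙ` of a real
entire function are symmetric with multiplicity. [Conway 1978, Ch. XI (Hadamard) with the
reflection principle] [folklore] -/
theorem ncard_fiber_conj {b : ℕ → ℂ} (hb : Summable fun n => ‖b n‖) {g : ℂ → ℂ}
    (hprod : ∀ z, HasProd (fun n => 1 - b n * z) (g z)) (hg : ∀ z, g (conj z) = conj (g z))
    {β : ℂ} (hβ : β ≠ 0) : {n | b n = β}.ncard = {n | b n = conj β}.ncard := by
  -- the conjugate representation `g(z) = ∏ (1 - conj bₙ z)`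
  have hb' : Summable fun n => ‖conj (b n)‖ := by simpa using hb
  have hprod' : ∀ z, HasProd (fun n => 1 - conj (b n) * z) (g z) := by
    intro z
    have h := (hprod (conj z)).map (starRingEnd ℂ) Complex.continuous_conj
    rw [hg, Complex.conj_conj] at h
    convert h using 1
    funext n
    simp
  obtain ⟨G₁, hG₁c, hG₁0, hG₁⟩ := hasProd_factor_fiber hb hprod hβ
  obtain ⟨G₂, hG₂c, hG₂0, hG₂⟩ := hasProd_factor_fiber hb' hprod' hβ
  have hk := eq_of_pow_mul_eq_pow_mul hβ hG₁c hG₂c hG₁0 hG₂0 fun z => (hG₁ z).symm.trans (hG₂ z)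
  rw [hk]
  congr 1
  ext n
  simp only [Set.mem_setOf_eq]
  constructor
  · intro h; rw [← h, Complex.conj_conj]
  · intro h; rw [h, Complex.conj_conj]

end Literature.Analysis.TotalPositivity

namespace Literature.Analysis.TotalPositivity

/-! ### Real entire functions: conjugation symmetry from real Taylor coefficients -/

/-- An entire function with real Taylor coefficients at `0` commutes with complex conjugation.
[folklore] -/
theorem map_conj_of_im_iteratedDeriv_eq_zero {F : ℂ → ℂ} (hF : Differentiable ℂ F)
    (hreal : ∀ n : ℕ, (iteratedDeriv n F 0).im = 0) (z : ℂ) : F (conj z) = conj (F z) := by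
  have h1 := Complex.hasSum_taylorSeries_of_entire hF 0 (conj z)
  have h2 : HasSum (fun n => conj ((n ! : ℂ)⁻¹ • (z - 0) ^ n • iteratedDeriv n F 0)) (conj (F z)) :=
    Complex.hasSum_conj'.2 (Complex.hasSum_taylorSeries_of_entire hF 0 z)
  refine h1.unique ?_
  have hre : ∀ n, conj (iteratedDeriv n F 0) = iteratedDeriv n F 0 := fun n =>
    Complex.conj_eq_iff_im.2 (hreal n)
  have key : (fun n => (n ! : ℂ)⁻¹ • (conj z - 0) ^ n • iteratedDeriv n F 0) =
      fun n => conj ((n ! : ℂ)⁻¹ • (z - 0) ^ n • iteratedDeriv n F 0) := by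
    funext n
    simp only [sub_zero, smul_eq_mul, map_mul, map_inv₀, map_natCast, map_pow, hre]
  rw [key]
  exact h2

/-! ### Conjugation-symmetric finite sub-products -/

/-- If a finite index set `s` meets the fibres of `b` over `β` and over `conj β` in equally many
points for every `β ≠ 0`, then `∏_{n ∈ s} (1 - conj(bₙ) z) = ∏_{n ∈ s} (1 - bₙ z)`. [folklore] -/
theorem prod_one_sub_conj_mul {b : ℕ → ℂ} {s : Finset ℕ}
    (hs : ∀ β : ℂ, β ≠ 0 →
      (s.filter fun n => b n = β).card = (s.filter fun n => b n = conj β).card)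
    (z : ℂ) : ∏ n ∈ s, (1 - conj (b n) * z) = ∏ n ∈ s, (1 - b n * z) := by
  classical
  -- the hypothesis also holds for `β = 0`
  have hs' : ∀ β : ℂ, (s.filter fun n => b n = β).card = (s.filter fun n => b n = conj β).card := by
    intro β
    by_cases hβ : β = 0
    · rw [hβ, map_zero]
    · exact hs β hβ
  have hmem : ∀ β : ℂ, β ∈ s.image b → conj β ∈ s.image b := by
    intro β hβ
    rw [Finset.mem_image] at hβ ⊢
    have hne : (s.filter fun n => b n = conj β).Nonempty := by
      rw [← Finset.card_pos, ← hs' β, Finset.card_pos]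
      obtain ⟨n, hn, hb⟩ := hβ
      exact ⟨n, Finset.mem_filter.2 ⟨hn, hb⟩⟩
    obtain ⟨n, hn⟩ := hne
    rw [Finset.mem_filter] at hn
    exact ⟨n, hn.1, hn.2⟩
  rw [Finset.prod_comp (fun β => 1 - conj β * z) b, Finset.prod_comp (fun β => 1 - β * z) b]
  refine Finset.prod_nbij' (fun β => conj β) (fun β => conj β) (fun β hβ => hmem β hβ)
    (fun β hβ => hmem β hβ) (fun β _ => Complex.conj_conj β) (fun β _ => Complex.conj_conj β)
    (fun β _ => ?_)
  rw [hs' β]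

/-- The symmetric truncation sets: all indices with `‖bₙ‖ ≥ 1/(M+1)` together with the first `M`
indices carrying a zero (padding) entry. [folklore] -/
def symmTrunc {b : ℕ → ℂ} (hb : Summable fun n => ‖b n‖) (M : ℕ) : Finset ℕ :=
  (finite_levelSet_of_summable_norm hb (ε := 1 / (M + 1)) (by positivity)).toFinset ∪
    (Finset.range M).filter fun n => b n = 0

/-- Membership in `symmTrunc`. [folklore] -/
theorem mem_symmTrunc {b : ℕ → ℂ} (hb : Summable fun n => ‖b n‖) (M n : ℕ) :
    n ∈ symmTrunc hb M ↔ 1 / ((M : ℝ) + 1) ≤ ‖b n‖ ∨ (n < M ∧ b n = 0) := by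
  simp [symmTrunc, Set.Finite.mem_toFinset]

/-- `symmTrunc` is monotone in `M`. [folklore] -/
theorem monotone_symmTrunc {b : ℕ → ℂ} (hb : Summable fun n => ‖b n‖) :
    Monotone (symmTrunc hb) := by
  intro M M' hMM' n hn
  rw [mem_symmTrunc] at hn ⊢
  rcases hn with h | ⟨h1, h2⟩
  · left
    refine le_trans ?_ h
    have : (M : ℝ) + 1 ≤ (M' : ℝ) + 1 := by exact_mod_cast Nat.succ_le_succ hMM'
    exact one_div_le_one_div_of_le (by positivity) this
  · exact Or.inr ⟨lt_of_lt_of_le h1 hMM', h2⟩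

/-- `symmTrunc hb M` exhausts `ℕ` as `M → ∞`. [folklore] -/
theorem tendsto_symmTrunc {b : ℕ → ℂ} (hb : Summable fun n => ‖b n‖) :
    Tendsto (symmTrunc hb) atTop atTop := by
  refine tendsto_atTop_finset_of_monotone (monotone_symmTrunc hb) fun n => ?_
  by_cases hn : b n = 0
  · exact ⟨n + 1, (mem_symmTrunc hb _ _).2 (Or.inr ⟨n.lt_succ_self, hn⟩)⟩
  · obtain ⟨M, hM⟩ := exists_nat_one_div_lt (norm_pos_iff.2 hn)
    exact ⟨M, (mem_symmTrunc hb _ _).2 (Or.inl hM.le)⟩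

/-- The fibre of a non-zero value inside `symmTrunc hb M`: all of it, or nothing. [folklore] -/
theorem filter_symmTrunc_eq {b : ℕ → ℂ} (hb : Summable fun n => ‖b n‖) (M : ℕ) {β : ℂ}
    (hβ : β ≠ 0) :
    ((symmTrunc hb M).filter fun n => b n = β) =
      if 1 / ((M : ℝ) + 1) ≤ ‖β‖ then (finite_fiber_of_summable_norm hb hβ).toFinset else ∅ := by
  ext n
  simp only [Finset.mem_filter, mem_symmTrunc]
  split_ifs with h
  · simp only [Set.Finite.mem_toFinset, Set.mem_setOf_eq]
    constructor
    · exact fun h' => h'.2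
    · intro h'
      exact ⟨Or.inl (h'.symm ▸ h), h'⟩
  · simp only [Finset.notMem_empty, iff_false, not_and]
    rintro (h1 | ⟨_, h2⟩) h3
    · exact h (h3 ▸ h1)
    · exact hβ (h3.symm.trans h2)

/-- **The symmetric partial products are real**: for a real `g = ∏ (1 - bₙ z)` (so that fibres over
`β` and `conj β` have the same size, `ncard_fiber_conj`), the finite product over `symmTrunc hb M`
commutes with conjugation of the data. [folklore] -/
theorem prod_symmTrunc_conj {b : ℕ → ℂ} (hb : Summable fun n => ‖b n‖) {g : ℂ → ℂ}
    (hprod : ∀ z, HasProd (fun n => 1 - b n * z) (g z)) (hg : ∀ z, g (conj z) = conj (g z))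
    (M : ℕ) (z : ℂ) :
    ∏ n ∈ symmTrunc hb M, (1 - conj (b n) * z) = ∏ n ∈ symmTrunc hb M, (1 - b n * z) := by
  refine prod_one_sub_conj_mul (fun β hβ => ?_) z
  have hβ' : conj β ≠ 0 := by simpa using hβ
  rw [filter_symmTrunc_eq hb M hβ, filter_symmTrunc_eq hb M hβ', Complex.norm_conj]
  split_ifs with h
  · rw [← Set.ncard_eq_toFinset_card _ (finite_fiber_of_summable_norm hb hβ),
      ← Set.ncard_eq_toFinset_card _ (finite_fiber_of_summable_norm hb hβ')]
    exact ncard_fiber_conj hb hprod hg hβ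
  · rfl

/-! ### The partial-product polynomials -/

/-- The partial-product polynomial `c ∏_{n ∈ s} (1 - bₙ X) ∈ ℂ[X]`. [folklore] -/
def truncPoly (c : ℂ) (b : ℕ → ℂ) (s : Finset ℕ) : ℂ[X] :=
  Polynomial.C c * ∏ n ∈ s, (1 - Polynomial.C (b n) * X)

/-- Evaluation of `truncPoly`. [folklore] -/
theorem eval_truncPoly (c : ℂ) (b : ℕ → ℂ) (s : Finset ℕ) (z : ℂ) :
    (truncPoly c b s).eval z = c * ∏ n ∈ s, (1 - b n * z) := by
  simp [truncPoly, Polynomial.eval_prod]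

/-- If the data are conjugation-symmetric on `s` and `c` is real, `truncPoly c b s` is fixed by
coefficientwise conjugation. [folklore] -/
theorem map_conj_truncPoly {c : ℂ} (hc : conj c = c) {b : ℕ → ℂ} {s : Finset ℕ}
    (hs : ∀ z : ℂ, ∏ n ∈ s, (1 - conj (b n) * z) = ∏ n ∈ s, (1 - b n * z)) :
    (truncPoly c b s).map (starRingEnd ℂ) = truncPoly c b s := by
  refine Polynomial.funext fun z => ?_
  rw [Polynomial.eval_map, ← Complex.conj_conj z, Polynomial.eval₂_hom, Complex.conj_conj,
    eval_truncPoly, eval_truncPoly, map_mul, hc, map_prod]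
  congr 1
  rw [← hs z]
  refine Finset.prod_congr rfl fun n _ => ?_
  simp

/-- A complex polynomial fixed by coefficientwise conjugation is the image of a real polynomial
with the real parts of its coefficients. [folklore] -/
theorem exists_map_ofReal_eq {Q : ℂ[X]} (hQ : Q.map (starRingEnd ℂ) = Q) :
    ∃ p : ℝ[X], p.map Complex.ofRealHom = Q ∧ ∀ n, p.coeff n = (Q.coeff n).re := by
  have hcoef : ∀ n, ((Q.coeff n).re : ℂ) = Q.coeff n := by
    intro n
    have h := congrArg (fun q : ℂ[X] => q.coeff n) hQ
    simp only [Polynomial.coeff_map] at h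
    exact Complex.conj_eq_iff_re.1 h
  obtain ⟨p, hp⟩ := (Polynomial.mem_lifts Q).1
    ((Polynomial.lifts_iff_coeff_lifts Q).2 fun n =>
      Set.mem_range.2 ⟨(Q.coeff n).re, (Complex.ofRealHom_eq_coe _).trans (hcoef n)⟩)
  refine ⟨p, hp, fun n => ?_⟩
  have h := congrArg (fun q : ℂ[X] => q.coeff n) hp
  simp only [Polynomial.coeff_map, Complex.ofRealHom_eq_coe] at h
  rw [← h, Complex.ofReal_re]

/-! ### Locally uniform convergence of the symmetric partial products -/

/-- Partial products of `∏ (1 + cₖ z)` along ANY exhausting sequence of finite index sets converge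
locally uniformly on balls. [folklore] -/
theorem tendstoLocallyUniformlyOn_finsetProd_one_add {c : ℕ → ℂ} (hc : Summable fun k => ‖c k‖)
    {u : ℕ → Finset ℕ} (hu : Tendsto u atTop atTop) (R : ℝ) :
    TendstoLocallyUniformlyOn (fun N z => ∏ k ∈ u N, (1 + c k * z))
      (fun z => ∏' k, (1 + c k * z)) atTop (ball (0 : ℂ) R) := by
  have h := Summable.hasProdLocallyUniformlyOn_one_add (f := fun k z => c k * z)
    (K := ball (0 : ℂ) R) isOpen_ball (hc.mul_right |R|) (Eventually.of_forall fun k z hz => ?_)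
    (fun k => (continuous_const.mul continuous_id).continuousOn)
  · rw [hasProdLocallyUniformlyOn_iff_tendstoLocallyUniformlyOn] at h
    intro v hv x hx
    obtain ⟨t, ht, htr⟩ := h v hv x hx
    exact ⟨t, ht, hu.eventually htr⟩
  · rw [norm_mul]
    refine mul_le_mul_of_nonneg_left ?_ (norm_nonneg _)
    rw [mem_ball_zero_iff] at hz
    exact hz.le.trans (le_abs_self R)

/-! ### The theorem -/

/-- **Katkova's limiting argument** [Katkova2006, proof of Thm. 1, arXiv p. 4], for a general real
entire function of order `< 1`: if `F` is entire with `‖F z‖ ≤ C exp(‖z‖^ρ)` for some `ρ < 1`,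
has real Taylor coefficients at `0`, `F(0) > 0`, and every zero `z` of `F` satisfies
`|arg z| ≥ πm/(m+1)` (i.e. `|π - arg z| ≤ π/(m+1)`), then the Taylor sequence `(F⁽ⁿ⁾(0)/n!)ₙ` is
`m`-times positive — GIVEN Hadamard's factorisation in genus `0` (`hH`, [Conway 1978, XI.3.4])
and Schoenberg's sector theorem (`hB`, [Katkova2006, §1 Thm. B]). Proof: `F = F(0) ∏ (1 - bₙ z)`;
the symmetric partial products `F(0) ∏_{n ∈ symmTrunc M} (1 - bₙ z)` are real polynomials
(`prod_symmTrunc_conj`), positive at `0`, zero-free in the open sector (their zeros `1/bₙ` are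
zeros of `F`), hence `PF_m` by Thm. B; they converge to `F` locally uniformly, so their Taylor
coefficients converge, and `PF_m` is closed under termwise limits.
[Schoenberg 1955] [cite: Katkova2006, Thm. 1 (proof, arXiv p. 4)] -/
theorem isMultiplyPositiveSeq_taylor_of_zeros_in_sector (hH : Literature.Analysis.Complex.hadamard_genus_zero)
    (hB : schoenberg_sector_pf) {m : ℕ} {F : ℂ → ℂ} (hF : IsEntireOfOrderLtOne F)
    (hreal : ∀ n : ℕ, (iteratedDeriv n F 0).im = 0) (h0 : 0 < (F 0).re)
    (hz : ∀ z : ℂ, F z = 0 → Real.pi * m / (m + 1) ≤ |z.arg|) :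
    IsMultiplyPositiveSeq m fun n => (iteratedDeriv n F 0).re / (n ! : ℝ) := by
  classical
  obtain ⟨hdiff, ρ, C, hρ, hbound⟩ := hF
  have hF0 : F 0 ≠ 0 := fun h => by rw [h] at h0; simp at h0
  obtain ⟨b, hb, hprod⟩ := hH F ρ C hdiff hρ hbound hF0
  -- `F 0` is real
  have hF0re : F 0 = ((F 0).re : ℂ) := by
    apply Complex.ext
    · simp
    · simpa using hreal 0
  have hF0conj : conj (F 0) = F 0 := by rw [hF0re, Complex.conj_ofReal]
  -- `g = F/F(0)` is real
  have hFconj : ∀ z, F (conj z) = conj (F z) := map_conj_of_im_iteratedDeriv_eq_zero hdiff hreal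
  have hg : ∀ z, (fun w => F w / F 0) (conj z) = conj ((fun w => F w / F 0) z) := by
    intro z
    simp only [map_div₀, hF0conj, hFconj z]
  -- the symmetric partial products
  set u : ℕ → Finset ℕ := symmTrunc hb with hu
  set Q : ℕ → ℂ[X] := fun M => truncPoly (F 0) b (u M) with hQ
  set P : ℕ → ℂ → ℂ := fun M z => (Q M).eval z with hP
  have hPeval : ∀ M z, P M z = F 0 * ∏ n ∈ u M, (1 - b n * z) := fun M z => eval_truncPoly _ _ _ _
  -- they are real polynomials
  have hQreal : ∀ M, (Q M).map (starRingEnd ℂ) = Q M := fun M =>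
    map_conj_truncPoly hF0conj (prod_symmTrunc_conj hb hprod hg M)
  -- locally uniform convergence `P M → F` on the unit ball
  have hc : Summable fun n => ‖-b n‖ := by simpa using hb
  have hunif : TendstoLocallyUniformlyOn P F atTop (ball (0 : ℂ) 1) := by
    have h1 := tendstoLocallyUniformlyOn_finsetProd_one_add hc (tendsto_symmTrunc hb) 1
    have h2 := (uniformContinuous_const_smul (F 0)).comp_tendstoLocallyUniformlyOn h1
      (F := fun N z => ∏ k ∈ u N, (1 + -b k * z))
    refine (h2.congr (G := P) fun M => ?_).congr_right fun z _ => ?_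
    · intro z _
      simp only [Function.comp_apply, smul_eq_mul, hPeval]
      congr 1
      exact Finset.prod_congr rfl fun n _ => by ring
    · simp only [Function.comp_apply, smul_eq_mul]
      have hp : HasProd (fun n => 1 + -b n * z) (F z / F 0) := by
        convert hprod z using 2 with n; ring
      rw [(hasProd_one_add hc z).unique hp, mul_div_cancel₀ _ hF0]
  -- convergence of the Taylor coefficients at `0`
  have hcoef : ∀ n, Tendsto (fun M => (iteratedDeriv n (P M) 0).re / (n ! : ℝ)) atTop
      (𝓝 ((iteratedDeriv n F 0).re / (n ! : ℝ))) := by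
    intro n
    have hPd : ∀ M, Differentiable ℂ (P M) := fun M => by
      simp only [hP]
      exact Polynomial.differentiable _
    have h := (tendstoLocallyUniformlyOn_iteratedDeriv isOpen_ball hPd hunif n).tendsto_at
      (a := 0) (by simp)
    exact ((Complex.continuous_re.tendsto _).comp h).div_const _
  refine IsMultiplyPositiveSeq.of_tendsto (l := atTop) (fun M => ?_) hcoef
  -- each symmetric partial product has `PF_m` coefficients, by Theorem B
  obtain ⟨p, hp, hpcoeff⟩ := exists_map_ofReal_eq (hQreal M)
  have hcoeffs : (fun n => (iteratedDeriv n (P M) 0).re / (n ! : ℝ)) = fun n => p.coeff n := by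
    funext n
    rw [hpcoeff, hP, iteratedDeriv_polynomial_eval_zero, ← Complex.ofReal_natCast,
      Complex.re_ofReal_mul, mul_div_cancel_left₀]
    exact_mod_cast n.factorial_ne_zero
  rw [hcoeffs]
  have halg : algebraMap ℝ ℂ = Complex.ofRealHom := RingHom.ext fun _ => rfl
  refine hB m p ?_ fun z hzarg hzero => ?_
  · -- `p(0) = F(0) > 0`
    have hQ0 : (Q M).eval 0 = F 0 := by
      rw [show (Q M).eval 0 = P M 0 from rfl, hPeval]
      simp
    rw [hpcoeff, Polynomial.coeff_zero_eq_eval_zero, hQ0]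
    exact h0
  · -- a zero of `p` in the open sector would be a zero `1/bₙ` of `F`
    have heval : (Q M).eval z = 0 := by
      rw [← hp, Polynomial.eval_map]
      rwa [Polynomial.aeval_def, halg] at hzero
    rw [show (Q M).eval z = P M z from rfl, hPeval, mul_eq_zero, Finset.prod_eq_zero_iff] at heval
    rcases heval with h | ⟨n, -, hn⟩
    · exact hF0 h
    · have hFz : F z = 0 := by
        have h1 : HasProd (fun k => 1 - b k * z) 0 := hasProd_zero_of_exists_eq_zero ⟨n, hn⟩
        have := (hprod z).unique h1
        rcases div_eq_zero_iff.1 this with h | h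
        · exact h
        · exact absurd h hF0
      exact absurd (hz z hFz) (not_le.2 hzarg)

end Literature.Analysis.TotalPositivity
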